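import Mathlib
import HarnessLib
import Summits.Ventures.LatticeQCDFlow.Scaling.AcceptanceVolumeSandwichIntegral

/-!
# LatticeQCDFlow / Scaling — rigidity of the worst-block acceptance ceiling on a GENERAL space, I:
# near-ratio pairs, the inner equality case, the product acceptance in re-paired weight form

HONEST FRAMING: exact (Metropolis-corrected) sampling algorithms for lattice gauge theory;
figures of merit are autocorrelation/cost numbers at stated couplings and volumes; no
continuum-physics claim.

Venture `LatticeQCDFlow` (cell pub-lqcd), topic `Scaling`; FANOUT row 3 (`s0-u1-a`, S0-B
implementation A, GEN-14).  NEW WORK of the cell (elementary measure theory): the tools for the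
general-space form of the worst-block half of row 3's finite `Scaling/AcceptanceVolumeCeilingRigidity`
(`accRate_prodLaw_eq_left_iff`, which reads the defect off the DIAGONAL atom `(x₀, x₀)` of the
counting measure — an argument that is void on an atomless space and is replaced here by an
approximation argument OFF the diagonal), in the setting of row 3's
`Scaling/AcceptanceVolumeSandwichIntegral` (imported: s-finite reference measures `μ` on `X`, `μ′`
on `Y`, targets `p, p′ ≥ 0` with `∫ = 1`, models `q, q′ > 0` whose laws `q dμ`, `q′ dμ′` are
probability measures, `acc(p, q) = ∫∫ min(p(a)q(b), p(b)q(a)) dμ dμ`, the re-pairing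
`measurePreserving_rePair`).  NO definition is introduced.

* §1 pigeonhole off the diagonal: if `{0 < w}` is not null then for every `r > 1` some geometric
  shell `{r^k ≤ w < r^(k+1)}` is charged (`exists_measure_zpowShell_pos`), so the NEAR-RATIO pair
  set `{0 < w(a), 0 < w(b), w(b) < r·w(a), w(a) < r·w(b)}` has positive pair measure
  (**`measure_nearRatio_pos`**) — the substitute for the diagonal atom;
* §2 one pair of outer weights `A, B ≥ 0` against an inner weight `w′ ≥ 0` of unit mean under a
  probability law `ν′`: `∫ min(A·w′(c), B·w′(d)) d(ν′⊗ν′) ≤ min(A, B)`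
  (`integral_innerKernel_le_min`) and the EQUALITY CASE **`ae_le_mul_of_integral_innerKernel_eq`**:
  equality for positive `A, B` with `B ≤ rA`, `A ≤ rB` forces `w′(c) ≤ r·w′(d)` for `ν′⊗ν′`-a.e.
  `(c, d)` (the kernel must coincide a.e. with its dominating side; swap symmetry of `ν′⊗ν′`);
* §3 two blocks: `integrable_rePairKernel`, **`meanAccept_prod_eq_integral_rePair`** — the
  acceptance of the product pair as `∫ (∫ min(w(a)w′(c), w(b)w′(d)) d(ν′⊗ν′)) d(ν⊗ν)` with
  `ν = q dμ`, `ν′ = q′ dμ′`, `w = p/q`, `w′ = p′/q′` (Fubini after re-pairing), and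
  `measure_weight_pos_ne_zero` (`{0 < w}` is not `ν`-null since `∫ w dν = 1`).

The rigidity theorem itself (`acc(p⊗p′, q⊗q′) = acc(p, q) ↔ p′ =ᵐ[μ′] q′`, strict otherwise) is the
companion file `Scaling/AcceptanceVolumeCeilingRigidityIntegralEq`.  NOT CLAIMED: a quantitative
defect; the `m`-block (`Measure.pi`) form; any acceptance of ours; nothing re-scored.
-/

namespace Summit.Ventures.LatticeQCDFlow.Theory2

open MeasureTheory Set Filter Topology
open Summit.Ventures.LatticeQCDFlow.Scoring.AllPairsVariance

/-! ## §1 Pigeonhole off the diagonal: near-ratio pairs have positive measure -/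

section Pigeonhole

variable {X : Type*} [MeasurableSpace X] {ν : Measure X}

/-- **Geometric pigeonhole.** If `{0 < w}` is not `ν`-null then for every `r > 1` some shell
`{r^k ≤ w < r^(k+1)}` (`k ∈ ℤ`) has positive `ν`-measure. [folklore] -/
theorem exists_measure_zpowShell_pos {w : X → ℝ} (hpos : ν {x | 0 < w x} ≠ 0) {r : ℝ}
    (hr : 1 < r) : ∃ k : ℤ, 0 < ν {x | r ^ k ≤ w x ∧ w x < r ^ (k + 1)} := by
  by_contra h
  refine hpos (measure_mono_null (fun x hx => ?_)
    (measure_iUnion_null_iff.2 fun k : ℤ => nonpos_iff_eq_zero.1 (not_lt.1 (not_exists.1 h k))))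
  obtain ⟨k, hk⟩ := exists_mem_Ico_zpow (show 0 < w x from hx) hr
  exact mem_iUnion.2 ⟨k, hk.1, hk.2⟩

/-- **NEAR-RATIO PAIRS HAVE POSITIVE MEASURE.** If `{0 < w}` is not `ν`-null then for every `r > 1`
the pair set `{0 < w(a), 0 < w(b), w(b) < r·w(a), w(a) < r·w(b)}` has positive `ν⊗ν`-measure: it
contains the square of a charged geometric shell. [folklore] -/
theorem measure_nearRatio_pos [SFinite ν] {w : X → ℝ} (hpos : ν {x | 0 < w x} ≠ 0) {r : ℝ}
    (hr : 1 < r) :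
    0 < (ν.prod ν) {z : X × X | 0 < w z.1 ∧ 0 < w z.2 ∧ w z.2 < r * w z.1 ∧ w z.1 < r * w z.2} := by
  obtain ⟨k, hk⟩ := exists_measure_zpowShell_pos hpos hr
  have hr0 : 0 < r := zero_lt_one.trans hr
  have hrk : 0 < r ^ k := zpow_pos hr0 k
  have e : r ^ (k + 1) = r * r ^ k := by rw [zpow_add_one₀ hr0.ne', mul_comm]
  set B : Set X := {x | r ^ k ≤ w x ∧ w x < r ^ (k + 1)} with hB
  have hsub : B ×ˢ B
      ⊆ {z : X × X | 0 < w z.1 ∧ 0 < w z.2 ∧ w z.2 < r * w z.1 ∧ w z.1 < r * w z.2} := by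
    rintro ⟨a, b⟩ ⟨⟨ha1, ha2⟩, ⟨hb1, hb2⟩⟩
    refine ⟨hrk.trans_le ha1, hrk.trans_le hb1, ?_, ?_⟩
    · calc w b < r ^ (k + 1) := hb2
        _ = r * r ^ k := e
        _ ≤ r * w a := mul_le_mul_of_nonneg_left ha1 hr0.le
    · calc w a < r ^ (k + 1) := ha2
        _ = r * r ^ k := e
        _ ≤ r * w b := mul_le_mul_of_nonneg_left hb1 hr0.le
  calc (0 : ENNReal) < ν B * ν B := ENNReal.mul_pos hk.ne' hk.ne'
    _ = (ν.prod ν) (B ×ˢ B) := (Measure.prod_prod B B).symm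
    _ ≤ _ := measure_mono hsub

end Pigeonhole

/-! ## §2 One pair of outer weights against an inner weight of unit mean -/

section Inner

variable {Y : Type*} [MeasurableSpace Y] {ν' : Measure Y} [IsProbabilityMeasure ν'] {w' : Y → ℝ}

/-- The inner kernel `(c, d) ↦ min(A·w′(c), B·w′(d))` is integrable on `ν′⊗ν′`. [folklore] -/
theorem integrable_innerKernel (hw0 : ∀ y, 0 ≤ w' y) (hwm : Measurable w')
    (hwi : Integrable w' ν') {A B : ℝ} (hA : 0 ≤ A) (hB : 0 ≤ B) :
    Integrable (fun cd : Y × Y => min (A * w' cd.1) (B * w' cd.2)) (ν'.prod ν') := by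
  refine ((hwi.comp_fst ν').const_mul A).mono'
    ((measurable_const.mul (hwm.comp measurable_fst)).min
      (measurable_const.mul (hwm.comp measurable_snd))).aestronglyMeasurable
    (Eventually.of_forall fun cd => ?_)
  rw [Real.norm_of_nonneg (le_min (mul_nonneg hA (hw0 _)) (mul_nonneg hB (hw0 _)))]
  exact min_le_left _ _

/-- `∫ A·w′(c) d(ν′⊗ν′)(c, d) = A` for an inner weight of unit mean. [folklore] -/
theorem integral_const_mul_weight_fst (hw1 : ∫ y, w' y ∂ν' = 1) (A : ℝ) :
    ∫ cd : Y × Y, A * w' cd.1 ∂(ν'.prod ν') = A := by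
  have h := integral_fun_fst (μ := ν') (ν := ν') w'
  rw [probReal_univ, one_smul] at h
  rw [integral_const_mul, h, hw1, mul_one]

/-- `∫ B·w′(d) d(ν′⊗ν′)(c, d) = B` for an inner weight of unit mean. [folklore] -/
theorem integral_const_mul_weight_snd (hw1 : ∫ y, w' y ∂ν' = 1) (B : ℝ) :
    ∫ cd : Y × Y, B * w' cd.2 ∂(ν'.prod ν') = B := by
  have h := integral_fun_snd (μ := ν') (ν := ν') w'
  rw [probReal_univ, one_smul] at h
  rw [integral_const_mul, h, hw1, mul_one]

/-- **The inner ceiling**: `∫ min(A·w′(c), B·w′(d)) d(ν′⊗ν′) ≤ min(A, B)` for `A, B ≥ 0` and an inner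
weight `w′ ≥ 0` of unit mean. [ours] -/
theorem integral_innerKernel_le_min (hw0 : ∀ y, 0 ≤ w' y) (hwi : Integrable w' ν')
    (hw1 : ∫ y, w' y ∂ν' = 1) {A B : ℝ} (hA : 0 ≤ A) (hB : 0 ≤ B) :
    ∫ cd, min (A * w' cd.1) (B * w' cd.2) ∂(ν'.prod ν') ≤ min A B := by
  have hnn : 0 ≤ᵐ[ν'.prod ν'] fun cd : Y × Y => min (A * w' cd.1) (B * w' cd.2) :=
    Eventually.of_forall fun cd => le_min (mul_nonneg hA (hw0 _)) (mul_nonneg hB (hw0 _))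
  refine le_min ?_ ?_
  · calc ∫ cd, min (A * w' cd.1) (B * w' cd.2) ∂(ν'.prod ν')
        ≤ ∫ cd : Y × Y, A * w' cd.1 ∂(ν'.prod ν') :=
          integral_mono_of_nonneg hnn ((hwi.comp_fst ν').const_mul A)
            (Eventually.of_forall fun cd => min_le_left _ _)
      _ = A := integral_const_mul_weight_fst hw1 A
  · calc ∫ cd, min (A * w' cd.1) (B * w' cd.2) ∂(ν'.prod ν')
        ≤ ∫ cd : Y × Y, B * w' cd.2 ∂(ν'.prod ν') :=
          integral_mono_of_nonneg hnn ((hwi.comp_snd ν').const_mul B)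
            (Eventually.of_forall fun cd => min_le_right _ _)
      _ = B := integral_const_mul_weight_snd hw1 B

/-- **THE INNER EQUALITY CASE.** If `∫ min(A·w′(c), B·w′(d)) d(ν′⊗ν′) = min(A, B)` for positive outer
weights with `B ≤ r·A` and `A ≤ r·B`, then `w′(c) ≤ r·w′(d)` for `ν′⊗ν′`-a.e. `(c, d)`: in the case
`A ≤ B` the kernel must equal `A·w′(c)` a.e.; in the case `B ≤ A` it must equal `B·w′(d)` a.e., and
the swap symmetry of `ν′⊗ν′` turns the conclusion round. [ours] -/
theorem ae_le_mul_of_integral_innerKernel_eq (hw0 : ∀ y, 0 ≤ w' y) (hwm : Measurable w')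
    (hwi : Integrable w' ν') (hw1 : ∫ y, w' y ∂ν' = 1) {A B r : ℝ} (hA : 0 < A) (hB : 0 < B)
    (hBA : B ≤ r * A) (hAB : A ≤ r * B)
    (h : ∫ cd, min (A * w' cd.1) (B * w' cd.2) ∂(ν'.prod ν') = min A B) :
    ∀ᵐ cd ∂(ν'.prod ν'), w' cd.1 ≤ r * w' cd.2 := by
  have hKi := integrable_innerKernel hw0 hwm hwi hA.le hB.le
  rcases le_total A B with hle | hle
  · -- `min A B = A`: the kernel equals `A·w′(c)` almost everywhere
    rw [min_eq_left hle] at h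
    have hg0 : 0 ≤ fun cd : Y × Y => A * w' cd.1 - min (A * w' cd.1) (B * w' cd.2) :=
      fun cd => sub_nonneg.2 (min_le_left _ _)
    have hgi : Integrable (fun cd : Y × Y => A * w' cd.1 - min (A * w' cd.1) (B * w' cd.2))
        (ν'.prod ν') := ((hwi.comp_fst ν').const_mul A).sub hKi
    have hint : ∫ cd, (A * w' cd.1 - min (A * w' cd.1) (B * w' cd.2)) ∂(ν'.prod ν') = 0 := by
      rw [integral_sub ((hwi.comp_fst ν').const_mul A) hKi, h, integral_const_mul_weight_fst hw1 A,
        sub_self]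
    filter_upwards [(integral_eq_zero_iff_of_nonneg hg0 hgi).1 hint] with cd hcd
    have hcd' : A * w' cd.1 ≤ B * w' cd.2 := by
      have e : A * w' cd.1 = min (A * w' cd.1) (B * w' cd.2) := sub_eq_zero.1 hcd
      rw [e]
      exact min_le_right _ _
    have h2 : A * w' cd.1 ≤ A * (r * w' cd.2) :=
      hcd'.trans (by nlinarith [hw0 cd.2])
    exact le_of_mul_le_mul_left h2 hA
  · -- `min A B = B`: the kernel equals `B·w′(d)` almost everywhere; then swap
    rw [min_eq_right hle] at h
    have hg0 : 0 ≤ fun cd : Y × Y => B * w' cd.2 - min (A * w' cd.1) (B * w' cd.2) :=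
      fun cd => sub_nonneg.2 (min_le_right _ _)
    have hgi : Integrable (fun cd : Y × Y => B * w' cd.2 - min (A * w' cd.1) (B * w' cd.2))
        (ν'.prod ν') := ((hwi.comp_snd ν').const_mul B).sub hKi
    have hint : ∫ cd, (B * w' cd.2 - min (A * w' cd.1) (B * w' cd.2)) ∂(ν'.prod ν') = 0 := by
      rw [integral_sub ((hwi.comp_snd ν').const_mul B) hKi, h, integral_const_mul_weight_snd hw1 B,
        sub_self]
    have hae : ∀ᵐ cd ∂(ν'.prod ν'), w' cd.2 ≤ r * w' cd.1 := by
      filter_upwards [(integral_eq_zero_iff_of_nonneg hg0 hgi).1 hint] with cd hcd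
      have hcd' : B * w' cd.2 ≤ A * w' cd.1 := by
        have e : B * w' cd.2 = min (A * w' cd.1) (B * w' cd.2) := sub_eq_zero.1 hcd
        rw [e]
        exact min_le_left _ _
      have h2 : B * w' cd.2 ≤ B * (r * w' cd.1) :=
        hcd'.trans (by nlinarith [hw0 cd.1])
      exact le_of_mul_le_mul_left h2 hB
    exact (Measure.measurePreserving_swap (μ := ν') (ν := ν')).quasiMeasurePreserving.ae hae

end Inner

/-! ## §3 Two blocks: the product acceptance in re-paired weight form -/

section TwoBlocks

variable {X Y : Type*} [MeasurableSpace X] [MeasurableSpace Y] {μ : Measure X} {μ' : Measure Y}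
  [SFinite μ] [SFinite μ'] {p q : X → ℝ} {p' q' : Y → ℝ}

omit [SFinite μ] [SFinite μ'] in
/-- The re-paired weight kernel `min(w(a)w′(c), w(b)w′(d))` is integrable on
`((q dμ)⊗(q dμ)) ⊗ ((q′ dμ′)⊗(q′ dμ′))` (dominated by `w(a)·w′(c)`). [ours] -/
theorem integrable_rePairKernel (hp0 : ∀ x, 0 ≤ p x) (hpm : Measurable p) (hpi : Integrable p μ)
    (hq0 : ∀ x, 0 < q x) (hqm : Measurable q) (hp0' : ∀ y, 0 ≤ p' y) (hpm' : Measurable p')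
    (hpi' : Integrable p' μ') (hq0' : ∀ y, 0 < q' y) (hqm' : Measurable q')
    [IsProbabilityMeasure (μ.withDensity fun x => ENNReal.ofReal (q x))]
    [IsProbabilityMeasure (μ'.withDensity fun y => ENNReal.ofReal (q' y))] :
    Integrable (fun e : (X × X) × (Y × Y) =>
      min (p e.1.1 / q e.1.1 * (p' e.2.1 / q' e.2.1)) (p e.1.2 / q e.1.2 * (p' e.2.2 / q' e.2.2)))
      (((μ.withDensity fun x => ENNReal.ofReal (q x)).prod
          (μ.withDensity fun x => ENNReal.ofReal (q x))).prod
        ((μ'.withDensity fun y => ENNReal.ofReal (q' y)).prod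
          (μ'.withDensity fun y => ENNReal.ofReal (q' y)))) := by
  set ν := μ.withDensity fun x => ENNReal.ofReal (q x) with hν
  set ν' := μ'.withDensity fun y => ENNReal.ofReal (q' y) with hν'
  have hw : ∀ x, 0 ≤ p x / q x := fun x => div_nonneg (hp0 x) (hq0 x).le
  have hw' : ∀ y, 0 ≤ p' y / q' y := fun y => div_nonneg (hp0' y) (hq0' y).le
  obtain ⟨hwi, -⟩ := integral_weight_withDensity_eq (μ := μ) hpi hq0 hqm
  obtain ⟨hwi', -⟩ := integral_weight_withDensity_eq (μ := μ') hpi' hq0' hqm'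
  have hdom : Integrable (fun e : (X × X) × (Y × Y) => p e.1.1 / q e.1.1 * (p' e.2.1 / q' e.2.1))
      ((ν.prod ν).prod (ν'.prod ν')) :=
    (hwi.comp_fst ν).mul_prod (hwi'.comp_fst ν')
  have hKm : Measurable (fun e : (X × X) × (Y × Y) =>
      min (p e.1.1 / q e.1.1 * (p' e.2.1 / q' e.2.1)) (p e.1.2 / q e.1.2 * (p' e.2.2 / q' e.2.2))) :=
    (((hpm.div hqm).comp (measurable_fst.comp measurable_fst)).mul
      ((hpm'.div hqm').comp (measurable_fst.comp measurable_snd))).min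
      (((hpm.div hqm).comp (measurable_snd.comp measurable_fst)).mul
        ((hpm'.div hqm').comp (measurable_snd.comp measurable_snd)))
  refine hdom.mono' hKm.aestronglyMeasurable (Eventually.of_forall fun e => ?_)
  rw [Real.norm_of_nonneg (le_min (mul_nonneg (hw _) (hw' _)) (mul_nonneg (hw _) (hw' _)))]
  exact min_le_left _ _

/-- **The acceptance of the product pair in re-paired weight form**:
`acc(p⊗p′, q⊗q′) = ∫ (∫ min(w(a)w′(c), w(b)w′(d)) d(ν′⊗ν′)(c,d)) d(ν⊗ν)(a,b)` with `ν = q dμ`,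
`ν′ = q′ dμ′`, `w = p/q`, `w′ = p′/q′`. [ours] -/
theorem meanAccept_prod_eq_integral_rePair (hp0 : ∀ x, 0 ≤ p x) (hpm : Measurable p)
    (hpi : Integrable p μ) (hq0 : ∀ x, 0 < q x) (hqm : Measurable q) (hqi : Integrable q μ)
    (hp0' : ∀ y, 0 ≤ p' y) (hpm' : Measurable p') (hpi' : Integrable p' μ') (hq0' : ∀ y, 0 < q' y)
    (hqm' : Measurable q') (hqi' : Integrable q' μ')
    [IsProbabilityMeasure (μ.withDensity fun x => ENNReal.ofReal (q x))]
    [IsProbabilityMeasure (μ'.withDensity fun y => ENNReal.ofReal (q' y))] :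
    ∫ z, ∫ z', min (p z.1 * p' z.2 * (q z'.1 * q' z'.2)) (p z'.1 * p' z'.2 * (q z.1 * q' z.2))
        ∂(μ.prod μ') ∂(μ.prod μ')
      = ∫ ab, ∫ cd, min (p ab.1 / q ab.1 * (p' cd.1 / q' cd.1)) (p ab.2 / q ab.2 * (p' cd.2 / q' cd.2))
          ∂((μ'.withDensity fun y => ENNReal.ofReal (q' y)).prod
              (μ'.withDensity fun y => ENNReal.ofReal (q' y)))
          ∂((μ.withDensity fun x => ENNReal.ofReal (q x)).prod
              (μ.withDensity fun x => ENNReal.ofReal (q x))) := by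
  set ν := μ.withDensity fun x => ENNReal.ofReal (q x) with hν
  set ν' := μ'.withDensity fun y => ENNReal.ofReal (q' y) with hν'
  have hP0 : ∀ z : X × Y, 0 ≤ p z.1 * p' z.2 := fun z => mul_nonneg (hp0 _) (hp0' _)
  have hPm : Measurable (fun z : X × Y => p z.1 * p' z.2) :=
    (hpm.comp measurable_fst).mul (hpm'.comp measurable_snd)
  have hPi : Integrable (fun z : X × Y => p z.1 * p' z.2) (μ.prod μ') := hpi.mul_prod hpi'
  have hQ0 : ∀ z : X × Y, 0 < q z.1 * q' z.2 := fun z => mul_pos (hq0 _) (hq0' _)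
  have hQm : Measurable (fun z : X × Y => q z.1 * q' z.2) :=
    (hqm.comp measurable_fst).mul (hqm'.comp measurable_snd)
  have hQi : Integrable (fun z : X × Y => q z.1 * q' z.2) (μ.prod μ') := hqi.mul_prod hqi'
  have hN : (μ.prod μ').withDensity (fun z : X × Y => ENNReal.ofReal (q z.1 * q' z.2)) = ν.prod ν' :=
    prodModel_withDensity_eq hq0 hqm hqm'
  rw [← integral_pairMin_withDensity_eq_meanAccept (μ := μ.prod μ') hP0 hPm hPi hQ0 hQm hQi, hN]
  have hW : ∀ z : X × Y, p z.1 * p' z.2 / (q z.1 * q' z.2) = p z.1 / q z.1 * (p' z.2 / q' z.2) :=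
    fun z => mul_div_mul_comm _ _ _ _
  simp_rw [hW]
  -- transport the product kernel to the re-paired space
  have hT := measurePreserving_rePair ν ν'
  have hK'm : Measurable (fun e : (X × X) × (Y × Y) =>
      min (p e.1.1 / q e.1.1 * (p' e.2.1 / q' e.2.1)) (p e.1.2 / q e.1.2 * (p' e.2.2 / q' e.2.2))) :=
    (((hpm.div hqm).comp (measurable_fst.comp measurable_fst)).mul
      ((hpm'.div hqm').comp (measurable_fst.comp measurable_snd))).min
      (((hpm.div hqm).comp (measurable_snd.comp measurable_fst)).mul
        ((hpm'.div hqm').comp (measurable_snd.comp measurable_snd)))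
  have htrans : ∫ e, min (p e.1.1 / q e.1.1 * (p' e.1.2 / q' e.1.2))
      (p e.2.1 / q e.2.1 * (p' e.2.2 / q' e.2.2)) ∂((ν.prod ν').prod (ν.prod ν'))
      = ∫ e, min (p e.1.1 / q e.1.1 * (p' e.2.1 / q' e.2.1))
          (p e.1.2 / q e.1.2 * (p' e.2.2 / q' e.2.2)) ∂((ν.prod ν).prod (ν'.prod ν')) := by
    rw [← hT.map_eq, integral_map hT.measurable.aemeasurable hK'm.aestronglyMeasurable]
  rw [htrans, integral_prod _ (integrable_rePairKernel hp0 hpm hpi hq0 hqm hp0' hpm' hpi' hq0' hqm')]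

omit [SFinite μ] in
/-- **`{0 < w}` is not `(q dμ)`-null** for a normalised target: `∫ w d(q dμ) = ∫ p dμ = 1`.
[folklore] -/
theorem measure_weight_pos_ne_zero (hp0 : ∀ x, 0 ≤ p x) (hpi : Integrable p μ)
    (hp1 : ∫ x, p x ∂μ = 1) (hq0 : ∀ x, 0 < q x) (hqm : Measurable q) :
    (μ.withDensity fun x => ENNReal.ofReal (q x)) {x | 0 < p x / q x} ≠ 0 := by
  intro h0
  obtain ⟨-, hw1⟩ := integral_weight_withDensity_eq (μ := μ) hpi hq0 hqm
  have hae : (fun x => p x / q x) =ᵐ[μ.withDensity fun x => ENNReal.ofReal (q x)] fun _ => 0 := by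
    filter_upwards [measure_eq_zero_iff_ae_notMem.1 h0] with x hx
    exact le_antisymm (not_lt.1 hx) (div_nonneg (hp0 x) (hq0 x).le)
  rw [integral_congr_ae hae, integral_const, smul_zero, hp1] at hw1
  exact zero_ne_one hw1

end TwoBlocks

end Summit.Ventures.LatticeQCDFlow.Theory2
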